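import Summits.HodgeConjecture.HodgeConjecture.Theorems.R90S6TwistedTorusFibreSum             -- ★ TB2a FILE 2a (this seat): `iwasawaExp_mul_mul_qsInvolution_inv_of_diagonal`, `coe_mul_mul_qsInvolution_inv_of_diagonal`, `valuation_map_of_continuous_involution`; brings ★ 1c, ★ TJ1
import Literature.MeasureTheory.Group.InvariantQuotientCompactOpenMass                        -- ★ `quotientMeasure_image_mk_mul_eq`; brings ★ `InvariantQuotientNormalized` (`quotientMeasure`, `unfoldingConstant_quotientMeasure`, `lintegral_eq_unfoldingConstant_mul_lintegral_innerLIntegral`)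
import HarnessLib

/-!
# R90 · S6 «Ch. 14.1–14.5 stable TF» — CARD TB2a FILE 2c PIN, part A (row E1.4.4.2.1 ∕ TB2d): THE ε-TWISTED TORUS DESCENT AGAINST THE CANONICAL QUOTIENT
# MEASURES (no chain-rule constant) AND THE VOLUME OF THE ε-NORM FIBRE ANCHOR `μAT(U₀) = α(A ∩ K̃) ∕ t(T ∩ K̃)` (`Theorems/R90S6TwistedTorusDescentCanonical.lean`)

Cell `hodgecm-mathlib`, crux H413 (`stmt-HodgeConjecture-24833`), route of record `HCCMUnconditional`; programme R90-TF (brief `director/R90-BRIEF.v2.md`),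
section S6 (base `R90-C14`), seat R90-C14-p06 (g2); dealer R90-C14-plan (g2) 03:15:27Z («TB2a FILE 2c PIN → p06»: the canonical-quotient edition of ★ FILE 2b's
(V4) with its constant `c` and the volume `μAT(U₀)` EVALUATED).  This is part A (the two measure-theoretic inputs); part B `R90S6TwistedConstantTermValuePinned` is the
pinned value.  Lane `--kind proof --supports stmt-HodgeConjecture-24833 --as helper`; THEOREMS ONLY (no definition ∕ instance ∕ notation ∕ named fact ∕ `sorry`).

THE MATHEMATICS [Rogawski1990, §4.10 pp. 57–59, §4.3 (4.3.1) p. 43, §4.13 pp. 64–70; DeitmarEchterhoff2014 Thm. 1.5.3; Folland1995 Thm. 2.49].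
* §1 **`lintegral_descEpsConj_quotientMeasure_eq_mul_lintegral_torus_of_eq_smul_map`** (generic locally compact `G`, `ε : G →* G` continuous, `A ≥ T = G_{δε}` closed):
  ★ 1c `exists_lintegral_descEpsConj_eq_mul_lintegral_torus` for the CANONICAL triple `μGT := ν∕t`, `μGA := ν∕α`, `μAT := α∕t′` (★ `quotientMeasure`; `ν` Haar on
  `G` right invariant, `α` Haar on `A` right and inversion invariant, `t` Haar on `T` inversion invariant, `t′` its transport to `T ≤ A`, letter `ht'` — verbatim the
  currency of ★ `GLnLeviOrbitalDescentCanonicalOne`): the chain-rule constant is `1 · 1⁻¹ · 1⁻¹` (★ `lintegral_eq_unfoldingConstant_mul_lintegral_innerLIntegral`,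
  ★ `unfoldingConstant_quotientMeasure` ×3), so under the `K N A` letter `hq : ν∕α = C • π_*(κ ⊗ μ_N)` and the twist letter `hJac` (module `J`):
  `∫⁻_{G⧸T} F(y δ ε(y)⁻¹) d(ν∕t) = C · J · ∫⁻_{A⧸T} ∫⁻_{K×N} F(k ((aδε(a)⁻¹) n) ε(k)⁻¹) d(κ⊗μ_N) d(α∕t′)` — NO `∃ c`.
* §2 (`GL₃`, `ε = Θ_σ`, `δ = diag(d)`, `A = M_{id}`): **`setOf_descEpsConj_iwasawaExp_eq_image_mk`** — ★ 2a's ε-norm fibre anchor `U₀ = {aT : e(aδε(a)⁻¹) = e(δ)}` IS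
  `π_A(A ∩ K̃)` (the shift `τ = diag(x, 1, σ(x)⁻¹)` lies in `T_ε ∩ A` and has `e(τ) = (v(x), 0, −v(x))`), hence **`quotientMeasure_setOf_descEpsConj_iwasawaExp_mul_eq`**:
  `(α∕t′)(U₀) · t(T ∩ K̃) = α(A ∩ K̃)` (★ `quotientMeasure_image_mk_mul_eq` for the open subgroup `A ∩ K̃ ≤ A`).

HONEST LABEL: count-neutral bookkeeping (measure normalisation) until TB2d consumes part B; proves no printed statement, discharges no citation.  HC_CM is proved
only modulo the 7 printed citations (2 remaining named inputs: hLiu418 = stmt-HodgeConjecture-24832, h413 = stmt-HodgeConjecture-24833) until rung 0 closes;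
REL ≠ ★ ≠ BUILT.

## Tree search
★ `InvariantQuotientNormalized.{quotientMeasure, unfoldingConstant_quotientMeasure, lintegral_eq_unfoldingConstant_mul_lintegral_innerLIntegral, quotientMeasure_ne_zero}`;
★ `InvariantQuotientCompactOpenMass.quotientMeasure_image_mk_mul_eq`; ★ `GLnLeviOrbitalDescentCanonicalOne` §1 (pattern: instance preamble + `hchain`); ★ 1c
`lintegral_prod_twistedConj_eq_mul_of_epsTwist` (its `descEpsConj_epsCentralizer_apply_mk`, `measurable_descEpsConj_aux` are private — local copies below),
`measurable_innerLIntegral`, `innerLIntegral_mk`, `inclQuot_mk`, `continuous_inclQuot`, `continuous_subgroupOfEquivOfLe_symm`, `isClosed_subgroupOf`; ★ 2a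
`iwasawaExp_mul_mul_qsInvolution_inv_of_diagonal`, `iwasawaExp_eq_of_coe_eq_diagonal`, `coe_mul_mul_qsInvolution_inv_of_diagonal`, `valuation_map_of_continuous_involution`;
★ `diagonalGL_mem_glInt`, `coe_diagonalGL`, `exists_eq_zpow_mul_of_ne_zero`, `iwasawaExp_eq`, `zpowDiagGL_zero`, `mem_standardLeviGL_iff`, `mem_epsCentralizer_iff`.
Dedup: `rg "quotientMeasure_setOf_descEpsConj|torus_of_eq_smul_map|iwasawaExp_eq_image_mk"` — no hit.

## References
* [Rogawski1990] J. D. Rogawski, *Automorphic Representations of Unitary Groups in Three Variables*, Ann. of Math. Stud. 123 (1990), §4.3 p. 43, §4.10 pp. 57–59,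
  §4.13 pp. 64–70.
* [DeitmarEchterhoff2014] A. Deitmar, S. Echterhoff, *Principles of Harmonic Analysis*, 2nd ed. (2014), Thm. 1.5.3.
* [Folland1995] G. B. Folland, *A Course in Abstract Harmonic Analysis* (1995), §2.6 Thm. 2.49.
* [Kottwitz1986BaseChangeUnits] R. Kottwitz, *Base change for unit elements of Hecke algebras*, Compositio Math. 60 (1986), §3.
* [Macdonald1995] I. G. Macdonald, *Symmetric Functions and Hall Polynomials*, 2nd ed. (1995), Ch. V §2 (2.6).
-/

set_option autoImplicit false
-- the mandated namespace repeats the single-problem summit's segment (`HodgeConjecture.HodgeConjecture`)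
set_option linter.dupNamespace false

noncomputable section

open MeasureTheory Measure Set Function Filter Topology
open scoped ENNReal NNReal Pointwise MatrixGroups
open ValuativeRel MulAction Finset
open Literature.NumberTheory.Automorphic Literature.MeasureTheory.Group Literature.NumberTheory.Rogawski1990.Ch4Sec10
open Literature.NumberTheory.GaloisRepresentations Literature.NumberTheory.GaloisRepresentations.IsNonarchimedeanLocalField
open Literature.NumberTheory.Automorphic.heckeAlgebra

namespace Summit.HodgeConjecture.HodgeConjecture.R90.S6

/-! ## §1 The ε-twisted torus descent against the CANONICAL quotient measures (generic `G`): no chain-rule constant -/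

section PinnedDescent

variable {G : Type*} [Group G] (ε : G →* G) (δ : G)

/-- `descEpsConj ε δ G_{δε} φ (g G_{δε}) = φ(g δ ε(g)⁻¹)` (local copy of ★ 1c's private lemma). [cite: Rogawski1990, §1.6 p. 5] -/
private theorem descEpsConj_apply_mk₃ {β : Type*} (φ : G → β) (g : G) :
    descEpsConj ε δ (epsCentralizer ε δ) φ (QuotientGroup.mk g : G ⧸ epsCentralizer ε δ) = φ (g * δ * (ε g)⁻¹) := by
  obtain ⟨m, hm⟩ := QuotientGroup.mk_out_eq_mul (epsCentralizer ε δ) g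
  have hmδ : (m : G) * δ * (ε (m : G))⁻¹ = δ := (mem_epsCentralizer_iff ε δ _).1 m.2
  unfold descEpsConj
  rw [hm, map_mul]
  congr 1
  calc g * (m : G) * δ * (ε g * ε (m : G))⁻¹ = g * ((m : G) * δ * (ε (m : G))⁻¹) * (ε g)⁻¹ := by group
    _ = g * δ * (ε g)⁻¹ := by rw [hmδ]

variable [TopologicalSpace G] [IsTopologicalGroup G] [MeasurableSpace G] [BorelSpace G]

/-- the descended twisted integrand of a Borel `φ` is Borel for a continuous `ε` (local copy of ★ 1c's private lemma). [folklore] -/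
private theorem measurable_descEpsConj₃ [MeasurableSpace (G ⧸ epsCentralizer ε δ)] [BorelSpace (G ⧸ epsCentralizer ε δ)] (hε : Continuous ε)
    {β : Type*} [MeasurableSpace β] {φ : G → β} (hφ : Measurable φ) :
    Measurable (descEpsConj ε δ (epsCentralizer ε δ) φ) := by
  have hcomp : descEpsConj ε δ (epsCentralizer ε δ) (id : G → G) ∘ (QuotientGroup.mk : G → G ⧸ epsCentralizer ε δ) =
      fun g => g * δ * (ε g)⁻¹ :=
    funext fun g => descEpsConj_apply_mk₃ ε δ id g
  have hcont : Continuous (descEpsConj ε δ (epsCentralizer ε δ) (id : G → G)) := by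
    rw [← QuotientGroup.isOpenQuotientMap_mk.continuous_comp_iff, hcomp]
    exact (continuous_id.mul continuous_const).mul (hε.comp continuous_id).inv
  have heq : descEpsConj ε δ (epsCentralizer ε δ) φ = φ ∘ descEpsConj ε δ (epsCentralizer ε δ) (id : G → G) := rfl
  rw [heq]
  exact hφ.comp hcont.measurable

variable [LocallyCompactSpace G] [SecondCountableTopology G] [T2Space G]
  {Kc N : Subgroup G} (κ : Measure ↥Kc) [SFinite κ] (μN : Measure ↥N) [SFinite μN]

/-- **THE ε-TWISTED TORUS DESCENT AGAINST THE CANONICAL QUOTIENT MEASURES** (★ 1c `exists_lintegral_descEpsConj_eq_mul_lintegral_torus` with its chain-rule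
constant IDENTIFIED as `1`).  `G` locally compact second countable Hausdorff, `ε : G →* G` continuous, `δ ∈ G`, `A ≤ G` closed containing the closed ε-centraliser
`T = G_{δε}` (`hTA`); `ν` a Haar measure on `G` (right invariant), `α` on `A` (right and inversion invariant), `t` on `T` (inversion invariant), `t′` the transport
of `t` to `T ≤ A` (`ht'`); the `K N A` letter `hq : ν∕α = C • ((k,n) ↦ k n A)_* (κ ⊗ μ_N)` for the CANONICAL `ν∕α` and the twist letter `hJac` (ONE module `J` for
`n ↦ n (a δ ε(a)⁻¹) ε(n)⁻¹`, `a ∈ A`).  Then for every Borel `F ≥ 0`: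
**`∫⁻_{G⧸T} F(y δ ε(y)⁻¹) d(ν∕t) = C · J · ∫⁻_{A⧸T} ( ∫⁻_{K×N} F(k ((a δ ε(a)⁻¹) n) ε(k)⁻¹) d(κ ⊗ μ_N) ) d(α∕t′)(a)`** — integration in stages `G⧸T → G⧸A` with the
explicit constant `c_{ν∕t} · c_{ν∕α}⁻¹ · c_{α∕t′}⁻¹ = 1·1·1` (★ `lintegral_eq_unfoldingConstant_mul_lintegral_innerLIntegral`, ★ `unfoldingConstant_quotientMeasure`),
the `K N A` letter, Tonelli, and the twist step ★ 1c `lintegral_prod_twistedConj_eq_mul_of_epsTwist` at `m = a δ ε(a)⁻¹`.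
[cite: Rogawski1990, §4.10 pp. 57–59; §4.13 Lemma 4.13.1 (a) p. 64 and p. 70; §4.3 (4.3.1) p. 43] [cite: Folland1995, §2.6 Thm. 2.49] [cite: DeitmarEchterhoff2014, Thm. 1.5.3] -/
theorem lintegral_descEpsConj_quotientMeasure_eq_mul_lintegral_torus_of_eq_smul_map (hε : Continuous ε) {A : Subgroup G} (hA : IsClosed (A : Set G))
    (hT : IsClosed (epsCentralizer ε δ : Set G)) (hTA : epsCentralizer ε δ ≤ A)
    [MeasurableSpace (G ⧸ epsCentralizer ε δ)] [BorelSpace (G ⧸ epsCentralizer ε δ)] [MeasurableSpace (G ⧸ A)] [BorelSpace (G ⧸ A)]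
    [MeasurableSpace (↥A ⧸ (epsCentralizer ε δ).subgroupOf A)] [BorelSpace (↥A ⧸ (epsCentralizer ε δ).subgroupOf A)]
    (ν : Measure G) [IsHaarMeasure ν] [ν.IsMulRightInvariant]
    (α : Measure ↥A) [IsHaarMeasure α] [α.IsMulRightInvariant] [α.IsInvInvariant]
    (t : Measure ↥(epsCentralizer ε δ)) [IsHaarMeasure t] [t.IsInvInvariant]
    (t' : Measure ↥((epsCentralizer ε δ).subgroupOf A)) [IsHaarMeasure t'] [t'.IsInvInvariant]
    (ht' : t' = Measure.map (Subgroup.subgroupOfEquivOfLe hTA).symm t)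
    {C : ℝ≥0} (hq : quotientMeasure A α hA ν = C • Measure.map (fun p : ↥Kc × ↥N => (QuotientGroup.mk ((p.1 : G) * (p.2 : G)) : G ⧸ A)) (κ.prod μN))
    {J : ℝ≥0∞} (hJac : ∀ a : ↥A, ∀ Φ : G → ℝ≥0∞, Measurable Φ →
      ∫⁻ n, Φ ((n : G) * ((a : G) * δ * (ε (a : G))⁻¹) * (ε (n : G))⁻¹) ∂μN = J * ∫⁻ n, Φ (((a : G) * δ * (ε (a : G))⁻¹) * (n : G)) ∂μN)
    {F : G → ℝ≥0∞} (hF : Measurable F) :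
    ∫⁻ y, descEpsConj ε δ (epsCentralizer ε δ) F y ∂(quotientMeasure (epsCentralizer ε δ) t hT ν) =
      C * J * ∫⁻ z, descEpsConj ε δ (epsCentralizer ε δ)
        (fun m : G => ∫⁻ q : ↥Kc × ↥N, F ((q.1 : G) * (m * (q.2 : G)) * (ε (q.1 : G))⁻¹) ∂(κ.prod μN))
        (inclQuot (epsCentralizer ε δ) A z) ∂(quotientMeasure ((epsCentralizer ε δ).subgroupOf A) t' (isClosed_subgroupOf (epsCentralizer ε δ) A hT) α) := by
  haveI : IsClosed ((epsCentralizer ε δ : Subgroup G) : Set G) := hT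
  haveI : IsClosed ((A : Subgroup G) : Set G) := hA
  haveI : BorelSpace ↥Kc := Subtype.borelSpace _
  haveI : BorelSpace ↥N := Subtype.borelSpace _
  haveI : SecondCountableTopology ↥Kc := TopologicalSpace.Subtype.secondCountableTopology _
  haveI : SecondCountableTopology ↥N := TopologicalSpace.Subtype.secondCountableTopology _
  haveI : BorelSpace (↥Kc × ↥N) := Prod.borelSpace
  haveI : LocallyCompactSpace ↥A := hA.isClosedEmbedding_subtypeVal.locallyCompactSpace
  haveI : SecondCountableTopology ↥A := TopologicalSpace.Subtype.secondCountableTopology _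
  haveI : SFinite α := inferInstance
  haveI : SecondCountableTopology ↥(epsCentralizer ε δ) := TopologicalSpace.Subtype.secondCountableTopology _
  haveI : LocallyCompactSpace ↥(epsCentralizer ε δ) := hT.isClosedEmbedding_subtypeVal.locallyCompactSpace
  haveI : SFinite t := inferInstance
  haveI : IsClosed (((epsCentralizer ε δ).subgroupOf A : Subgroup ↥A) : Set ↥A) := isClosed_subgroupOf (epsCentralizer ε δ) A hT
  haveI : SecondCountableTopology ↥((epsCentralizer ε δ).subgroupOf A) := TopologicalSpace.Subtype.secondCountableTopology _
  haveI : LocallyCompactSpace ↥((epsCentralizer ε δ).subgroupOf A) :=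
    (isClosed_subgroupOf (epsCentralizer ε δ) A hT).isClosedEmbedding_subtypeVal.locallyCompactSpace
  haveI : SFinite t' := inferInstance
  haveI : SecondCountableTopology (↥A ⧸ (epsCentralizer ε δ).subgroupOf A) := inferInstance
  haveI : SFinite (quotientMeasure ((epsCentralizer ε δ).subgroupOf A) t' (isClosed_subgroupOf (epsCentralizer ε δ) A hT) α) := inferInstance
  haveI : BorelSpace ((↥Kc × ↥N) × (↥A ⧸ (epsCentralizer ε δ).subgroupOf A)) := Prod.borelSpace
  haveI : BorelSpace (G × (↥Kc × ↥N)) := Prod.borelSpace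
  have hGA : quotientMeasure A α hA ν ≠ 0 := quotientMeasure_ne_zero _ _ _ _
  have hAT : quotientMeasure ((epsCentralizer ε δ).subgroupOf A) t' (isClosed_subgroupOf (epsCentralizer ε δ) A hT) α ≠ 0 :=
    quotientMeasure_ne_zero _ _ _ _
  -- (1) integration in stages `G ⧸ T → G ⧸ A`, constants `1 · 1⁻¹ · 1⁻¹`
  have hf : Measurable (descEpsConj ε δ (epsCentralizer ε δ) F) := measurable_descEpsConj₃ ε δ hε hF
  have hchain := lintegral_eq_unfoldingConstant_mul_lintegral_innerLIntegral (epsCentralizer ε δ) A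
    (quotientMeasure (epsCentralizer ε δ) t hT ν) (quotientMeasure A α hA ν)
    (quotientMeasure ((epsCentralizer ε δ).subgroupOf A) t' (isClosed_subgroupOf (epsCentralizer ε δ) A hT) α) ν α t t' hTA ht' hGA hAT hf
  rw [unfoldingConstant_quotientMeasure (epsCentralizer ε δ) t ν, unfoldingConstant_quotientMeasure A α ν,
    unfoldingConstant_quotientMeasure ((epsCentralizer ε δ).subgroupOf A) t' α] at hchain
  rw [hchain]
  simp only [ENNReal.coe_one, inv_one, one_mul]
  -- (2) the `K N A` letter
  have hπ : Measurable fun q : ↥Kc × ↥N => (QuotientGroup.mk ((q.1 : G) * (q.2 : G)) : G ⧸ A) :=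
    ((QuotientGroup.continuous_mk (N := A)).comp
      ((continuous_subtype_val.comp continuous_fst).mul (continuous_subtype_val.comp continuous_snd))).measurable
  have hint : ∫⁻ y, innerLIntegral (epsCentralizer ε δ) A
        (quotientMeasure ((epsCentralizer ε δ).subgroupOf A) t' (isClosed_subgroupOf (epsCentralizer ε δ) A hT) α)
        (descEpsConj ε δ (epsCentralizer ε δ) F) y ∂quotientMeasure A α hA ν =
      ∫⁻ y, innerLIntegral (epsCentralizer ε δ) A
        (quotientMeasure ((epsCentralizer ε δ).subgroupOf A) t' (isClosed_subgroupOf (epsCentralizer ε δ) A hT) α)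
        (descEpsConj ε δ (epsCentralizer ε δ) F) y ∂(C • Measure.map
          (fun q : ↥Kc × ↥N => (QuotientGroup.mk ((q.1 : G) * (q.2 : G)) : G ⧸ A)) (κ.prod μN)) := by
    rw [← hq]
  rw [hint, lintegral_smul_measure,
    lintegral_map (measurable_innerLIntegral (epsCentralizer ε δ) A
      (quotientMeasure ((epsCentralizer ε δ).subgroupOf A) t' (isClosed_subgroupOf (epsCentralizer ε δ) A hT) α) hA hf) hπ]
  have hmk : ∀ q : ↥Kc × ↥N, innerLIntegral (epsCentralizer ε δ) A
        (quotientMeasure ((epsCentralizer ε δ).subgroupOf A) t' (isClosed_subgroupOf (epsCentralizer ε δ) A hT) α)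
        (descEpsConj ε δ (epsCentralizer ε δ) F) (QuotientGroup.mk ((q.1 : G) * (q.2 : G))) =
      ∫⁻ z, descEpsConj ε δ (epsCentralizer ε δ) F (((q.1 : G) * (q.2 : G)) • inclQuot (epsCentralizer ε δ) A z)
        ∂(quotientMeasure ((epsCentralizer ε δ).subgroupOf A) t' (isClosed_subgroupOf (epsCentralizer ε δ) A hT) α) :=
    fun q => innerLIntegral_mk _ _ _ _ _
  rw [lintegral_congr hmk]
  -- (3) Tonelli: swap `K × N` and `A ⧸ T`
  have hjoint : Measurable fun r : (↥Kc × ↥N) × (↥A ⧸ (epsCentralizer ε δ).subgroupOf A) =>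
      descEpsConj ε δ (epsCentralizer ε δ) F (((r.1.1 : G) * (r.1.2 : G)) • inclQuot (epsCentralizer ε δ) A r.2) :=
    hf.comp ((((continuous_subtype_val.comp continuous_fst).mul (continuous_subtype_val.comp continuous_snd)).comp continuous_fst).smul
      ((continuous_inclQuot (epsCentralizer ε δ) A).comp continuous_snd)).measurable
  rw [lintegral_lintegral_swap hjoint.aemeasurable]
  -- (4) the inner `K × N` integral at `z = a T`: the twist step at `m = a δ ε(a)⁻¹`
  have hinner : ∀ z : ↥A ⧸ (epsCentralizer ε δ).subgroupOf A,
      ∫⁻ q : ↥Kc × ↥N, descEpsConj ε δ (epsCentralizer ε δ) F (((q.1 : G) * (q.2 : G)) • inclQuot (epsCentralizer ε δ) A z) ∂(κ.prod μN) =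
        J * descEpsConj ε δ (epsCentralizer ε δ)
          (fun m : G => ∫⁻ q : ↥Kc × ↥N, F ((q.1 : G) * (m * (q.2 : G)) * (ε (q.1 : G))⁻¹) ∂(κ.prod μN))
          (inclQuot (epsCentralizer ε δ) A z) := by
    intro z
    induction z using QuotientGroup.induction_on with
    | H a =>
      have hpt : ∀ q : ↥Kc × ↥N, descEpsConj ε δ (epsCentralizer ε δ) F
            (((q.1 : G) * (q.2 : G)) • inclQuot (epsCentralizer ε δ) A (QuotientGroup.mk a)) =
          F ((q.1 : G) * ((q.2 : G) * ((a : G) * δ * (ε (a : G))⁻¹) * (ε (q.2 : G))⁻¹) * (ε (q.1 : G))⁻¹) := by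
        intro q
        rw [inclQuot_mk, MulAction.Quotient.smul_mk, smul_eq_mul, descEpsConj_apply_mk₃, map_mul, map_mul]
        congr 1
        group
      rw [lintegral_congr hpt, lintegral_prod_twistedConj_eq_mul_of_epsTwist ε κ μN hε _ (hJac a) hF]
      simp only [inclQuot_mk, descEpsConj_apply_mk₃]
  -- measurability of the outer integrand
  have hΨ : Measurable fun m : G => ∫⁻ q : ↥Kc × ↥N, F ((q.1 : G) * (m * (q.2 : G)) * (ε (q.1 : G))⁻¹) ∂(κ.prod μN) := by
    refine Measurable.lintegral_prod_right' (f := fun r : G × (↥Kc × ↥N) => F ((r.2.1 : G) * (r.1 * (r.2.2 : G)) * (ε (r.2.1 : G))⁻¹)) ?_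
    exact hF.comp ((((continuous_subtype_val.comp (continuous_fst.comp continuous_snd)).mul
      (continuous_fst.mul (continuous_subtype_val.comp (continuous_snd.comp continuous_snd)))).mul
      (hε.comp (continuous_subtype_val.comp (continuous_fst.comp continuous_snd))).inv).measurable)
  have houter : Measurable fun z : ↥A ⧸ (epsCentralizer ε δ).subgroupOf A => descEpsConj ε δ (epsCentralizer ε δ)
      (fun m : G => ∫⁻ q : ↥Kc × ↥N, F ((q.1 : G) * (m * (q.2 : G)) * (ε (q.1 : G))⁻¹) ∂(κ.prod μN)) (inclQuot (epsCentralizer ε δ) A z) :=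
    (measurable_descEpsConj₃ ε δ hε hΨ).comp (continuous_inclQuot (epsCentralizer ε δ) A).measurable
  rw [lintegral_congr hinner, lintegral_const_mul J houter, ENNReal.smul_def, smul_eq_mul]
  ring

end PinnedDescent

/-! ## §2 The volume of the ε-norm fibre anchor `U₀ ⊂ A ⧸ G̃_{δε}`: `U₀ = π_A(A ∩ K̃)` and `μAT(U₀) · t(T ∩ K̃) = α(A ∩ K̃)` -/

section Anchor

variable {K : Type*} [Field K] [ValuativeRel K] [TopologicalSpace K] [IsNonarchimedeanLocalField K]
  [IsDiscreteValuationRing 𝒪[K]] {ϖ : K} (hϖ : IsUniformizingElement ϖ)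
  (σ : K →+* K) (hσ : ∀ x, σ (σ x) = x) (hσc : Continuous σ)
  (ε : GL (Fin 3) K →* GL (Fin 3) K) (hεΘ : ∀ g, ε g = UnitaryGroup.qsInvolution σ g)
  (δ : GL (Fin 3) K) (d : Fin 3 → K) (hδ : (δ : Matrix (Fin 3) (Fin 3) K) = Matrix.diagonal d)

omit [ValuativeRel K] [TopologicalSpace K] [IsNonarchimedeanLocalField K] [IsDiscreteValuationRing 𝒪[K]] in
/-- an element of the diagonal torus has a diagonal matrix (local copy of ★ 2a's private lemma). [folklore] -/
private theorem coe_eq_diagonal_of_mem_standardLeviGL' {a : GL (Fin 3) K} (ha : a ∈ standardLeviGL K (_root_.id : Fin 3 → Fin 3)) :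
    (a : Matrix (Fin 3) (Fin 3) K) = Matrix.diagonal fun i => (a : Matrix (Fin 3) (Fin 3) K) i i := by
  ext i j
  by_cases hij : i = j
  · subst hij; rw [Matrix.diagonal_apply_eq]
  · rw [Matrix.diagonal_apply_ne _ hij]
    exact (mem_standardLeviGL_iff (_root_.id : Fin 3 → Fin 3) a).1 ha i j hij

omit [TopologicalSpace K] [IsNonarchimedeanLocalField K] [IsDiscreteValuationRing 𝒪[K]] in
/-- a `GL₃` element with a diagonal matrix of UNIT entries lies in `K̃ = GL₃(𝒪)` (★ `diagonalGL_mem_glInt`). [folklore] -/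
private theorem mem_glInt_of_coe_eq_diagonal {g : GL (Fin 3) K} {y : Fin 3 → K} (hg : (g : Matrix (Fin 3) (Fin 3) K) = Matrix.diagonal y)
    (hy : ∀ i, valuation K (y i) = 1) : g ∈ glInt 3 K := by
  have hy0 : ∀ i, y i ≠ 0 := fun i h => by have := hy i; rw [h, map_zero] at this; exact zero_ne_one this
  have hgd : g = diagonalGL (Fin 3) K (fun i => Units.mk0 (y i) (hy0 i)) := by
    apply Units.ext
    simp only [hg, coe_diagonalGL, Units.val_mk0]
  rw [hgd]
  exact diagonalGL_mem_glInt (fun i => hy i)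

omit [TopologicalSpace K] [IsNonarchimedeanLocalField K] in
include hϖ in
/-- `e(k) = 0` for `k ∈ K̃` (`k = 1 · ϖ⁰ · k`, ★ `iwasawaExp_eq`, ★ `zpowDiagGL_zero`). [cite: Macdonald1995, Ch. V §2 (2.6)] -/
private theorem iwasawaExp_eq_zero_of_mem_glInt {k : GL (Fin 3) K} (hk : k ∈ glInt 3 K) : iwasawaExp hϖ k = 0 :=
  iwasawaExp_eq hϖ (upperUnitriangular (Fin 3) K).one_mem hk (by rw [zpowDiagGL_zero, one_mul, one_mul])

include hϖ hσ hσc hεΘ hδ in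
/-- **THE ε-NORM FIBRE ANCHOR IS THE IMAGE OF `A ∩ K̃`**: with `T = G̃_{δε} ≤ A = M_{id}` and `e = iwasawaExp hϖ`,
`{aT ∈ A ⧸ T : e(a δ ε(a)⁻¹) = e(δ)} = π_A(A ∩ K̃)`.  (`e(aδε(a)⁻¹) = e(δ) + e(a) + w₀e(a)` ★ 2a, so the condition is `e(a) = (n, 0, −n)`; the shift
`τ = diag(ϖⁿ, 1, σ(ϖⁿ)⁻¹)` lies in `T_ε ∩ A` — `τ δ Θ(τ)⁻¹ = δ` by ★ 2a `coe_mul_mul_qsInvolution_inv_of_diagonal` — and `a τ ∈ A ∩ K̃` has unit entries since `σ` is an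
isometry ★ 2a `valuation_map_of_continuous_involution`; conversely `e(k) = 0` on `K̃`.) [cite: Rogawski1990, §4.10 Prop. 4.10.2 proof p. 59] [cite: Kottwitz1986BaseChangeUnits, §3] -/
theorem setOf_descEpsConj_iwasawaExp_eq_image_mk
    {A : Subgroup (GL (Fin 3) K)} (hAid : A = standardLeviGL K (_root_.id : Fin 3 → Fin 3)) (hTA : epsCentralizer ε δ ≤ A) :
    {z : ↥A ⧸ (epsCentralizer ε δ).subgroupOf A |
        descEpsConj ε δ (epsCentralizer ε δ) (fun m => iwasawaExp hϖ m) (inclQuot (epsCentralizer ε δ) A z) = iwasawaExp hϖ δ} =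
      (QuotientGroup.mk : ↥A → ↥A ⧸ (epsCentralizer ε δ).subgroupOf A) '' (((glInt 3 K).subgroupOf A : Subgroup ↥A) : Set ↥A) := by
  have _ := hTA
  have hvσ : ∀ x, valuation K (σ x) = valuation K x := valuation_map_of_continuous_involution σ hσ hσc
  have hmemA : ∀ a : ↥A, (a : GL (Fin 3) K) ∈ standardLeviGL K (_root_.id : Fin 3 → Fin 3) := fun a => hAid ▸ a.2
  have hϖ0 : ϖ ≠ 0 := hϖ.ne_zero
  have hvϖ0 : valuation K ϖ ≠ 0 := (map_ne_zero (valuation K)).2 hϖ0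
  -- the value of the anchor function at `aT`
  have hval : ∀ a : ↥A, descEpsConj ε δ (epsCentralizer ε δ) (fun m => iwasawaExp hϖ m) (inclQuot (epsCentralizer ε δ) A (QuotientGroup.mk a)) =
      fun i => iwasawaExp hϖ δ i + (iwasawaExp hϖ (a : GL (Fin 3) K) i + iwasawaExp hϖ (a : GL (Fin 3) K) i.rev) := by
    intro a
    rw [inclQuot_mk, descEpsConj_apply_mk₃, hεΘ,
      iwasawaExp_mul_mul_qsInvolution_inv_of_diagonal hϖ σ hvσ (coe_eq_diagonal_of_mem_standardLeviGL' (hmemA a)) hδ]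
  refine Set.Subset.antisymm ?_ ?_
  · intro z hz
    induction z using QuotientGroup.induction_on with
    | H a =>
      rw [Set.mem_setOf_eq, hval] at hz
      have h0 : iwasawaExp hϖ (a : GL (Fin 3) K) 0 + iwasawaExp hϖ (a : GL (Fin 3) K) 2 = 0 := by
        have := congrFun hz 0; simpa [Fin.rev] using this
      have h1 : iwasawaExp hϖ (a : GL (Fin 3) K) 1 = 0 := by
        have := congrFun hz 1; simp [Fin.rev] at this; omega
      -- unit decomposition of the entries of `a`
      set αv : Fin 3 → K := fun i => ((a : GL (Fin 3) K) : Matrix (Fin 3) (Fin 3) K) i i with hαv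
      have haα : ((a : GL (Fin 3) K) : Matrix (Fin 3) (Fin 3) K) = Matrix.diagonal αv := coe_eq_diagonal_of_mem_standardLeviGL' (hmemA a)
      have hdetα : (Matrix.diagonal αv).det ≠ 0 := by
        rw [← haα, ← Matrix.GeneralLinearGroup.val_det_apply]; exact (Matrix.GeneralLinearGroup.det (a : GL (Fin 3) K)).ne_zero
      rw [Matrix.det_diagonal] at hdetα
      have hα0 : ∀ i, αv i ≠ 0 := fun i => (Finset.prod_ne_zero_iff.1 hdetα) i (Finset.mem_univ i)
      choose ma ua hua hα using fun i => exists_eq_zpow_mul_of_ne_zero hϖ (hα0 i)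
      have hea : iwasawaExp hϖ (a : GL (Fin 3) K) = ma := iwasawaExp_eq_of_coe_eq_diagonal hϖ haα ma ua hua hα
      rw [hea] at h0 h1
      -- the shift `τ = diag(x, 1, σ(x)⁻¹)`, `x = ϖ^{ma 2}`
      set x : K := ϖ ^ (ma 2) with hx
      have hx0 : x ≠ 0 := zpow_ne_zero _ hϖ0
      have hσx0 : σ x ≠ 0 := fun h => hx0 (by rw [← hσ x, h, map_zero])
      set tv : Fin 3 → K := ![x, 1, (σ x)⁻¹] with htv
      have htv0 : ∀ i, tv i ≠ 0 := by
        intro i; fin_cases i <;> simp [htv, hx0, hσx0]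
      set τ : GL (Fin 3) K := diagonalGL (Fin 3) K (fun i => Units.mk0 (tv i) (htv0 i)) with hτ
      have hτcoe : (τ : Matrix (Fin 3) (Fin 3) K) = Matrix.diagonal tv := by
        simp only [hτ, coe_diagonalGL, Units.val_mk0]
      have hτA : τ ∈ A := by
        rw [hAid]
        exact (mem_standardLeviGL_iff (_root_.id : Fin 3 → Fin 3) τ).2 fun i j hij => by
          rw [hτcoe]; exact Matrix.diagonal_apply_ne _ hij
      -- `τ ∈ G̃_{δε}`: `τ δ Θ(τ)⁻¹ = δ`
      have hτT : τ ∈ epsCentralizer ε δ := by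
        rw [mem_epsCentralizer_iff, hεΘ]
        apply Units.ext
        rw [coe_mul_mul_qsInvolution_inv_of_diagonal σ hτcoe hδ, hδ]
        congr 1
        funext i
        fin_cases i
        · simp [htv, map_inv₀, hσ]
          field_simp
        · simp [htv]
        · simp [htv]
          field_simp
      -- `a τ ∈ K̃`: unit entries
      have hv0 : valuation K (αv 0 * tv 0) = 1 := by
        have htv0' : tv 0 = x := by simp [htv]
        rw [htv0', hα 0, hx, mul_assoc, mul_comm (ua 0), ← mul_assoc, ← zpow_add₀ hϖ0, h0, zpow_zero, one_mul, hua]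
      have hv1 : valuation K (αv 1 * tv 1) = 1 := by
        have htv1' : tv 1 = 1 := by simp [htv]
        rw [htv1', mul_one, hα 1, h1, zpow_zero, one_mul, hua]
      have hv2 : valuation K (αv 2 * tv 2) = 1 := by
        have htv2' : tv 2 = (σ x)⁻¹ := by simp [htv]
        rw [htv2', hα 2, hx, map_mul, map_mul, map_inv₀, hvσ, hua, mul_one]
        exact mul_inv_cancel₀ (by rw [map_zpow₀]; exact zpow_ne_zero _ hvϖ0)
      have haτ : ((a : GL (Fin 3) K) * τ : GL (Fin 3) K) ∈ glInt 3 K := by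
        refine mem_glInt_of_coe_eq_diagonal (y := fun i => αv i * tv i) ?_ fun i => ?_
        · rw [Units.val_mul, haα, hτcoe, Matrix.diagonal_mul_diagonal]
        · fin_cases i
          exacts [hv0, hv1, hv2]
      refine ⟨a * ⟨τ, hτA⟩, ?_, ?_⟩
      · exact Subgroup.mem_subgroupOf.2 (by rw [Subgroup.coe_mul]; exact haτ)
      · rw [QuotientGroup.eq, _root_.mul_inv_rev, inv_mul_cancel_right]
        exact Subgroup.mem_subgroupOf.2 ((epsCentralizer ε δ).inv_mem hτT)
  · rintro _ ⟨k, hk, rfl⟩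
    have hk' : ((k : ↥A) : GL (Fin 3) K) ∈ glInt 3 K := Subgroup.mem_subgroupOf.1 hk
    rw [Set.mem_setOf_eq, hval, iwasawaExp_eq_zero_of_mem_glInt hϖ hk']
    funext i
    simp

variable [MeasurableSpace (GL (Fin 3) K)] [BorelSpace (GL (Fin 3) K)]

include hϖ hσ hσc hεΘ hδ in
/-- **THE VOLUME OF THE ε-NORM FIBRE ANCHOR**: with `T = G̃_{δε} ≤ A` closed, `α` a Haar measure on `A` (right invariant), `t` a Haar measure on `T` (inversion
invariant) and `t′` its transport to `T ≤ A`, the canonical quotient measure `α∕t′` gives **`(α∕t′)(U₀) · t(T ∩ K̃) = α(A ∩ K̃)`**, `U₀ = {aT : e(aδε(a)⁻¹) = e(δ)}`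
(§2 `U₀ = π_A(A ∩ K̃)` and the mass formula ★ `quotientMeasure_image_mk_mul_eq` for the open subgroup `A ∩ K̃ ≤ A`).
[cite: DeitmarEchterhoff2014, Thm. 1.5.3] [cite: Rogawski1990, §4.3 (4.3.1) p. 43] -/
theorem quotientMeasure_setOf_descEpsConj_iwasawaExp_mul_eq
    [T2Space (GL (Fin 3) K)] [SecondCountableTopology (GL (Fin 3) K)] [LocallyCompactSpace (GL (Fin 3) K)]
    {A : Subgroup (GL (Fin 3) K)} (hAid : A = standardLeviGL K (_root_.id : Fin 3 → Fin 3)) (hA : IsClosed (A : Set (GL (Fin 3) K)))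
    (hT : IsClosed (epsCentralizer ε δ : Set (GL (Fin 3) K))) (hTA : epsCentralizer ε δ ≤ A)
    [MeasurableSpace (↥A ⧸ (epsCentralizer ε δ).subgroupOf A)] [BorelSpace (↥A ⧸ (epsCentralizer ε δ).subgroupOf A)]
    (α : Measure ↥A) [IsHaarMeasure α] [α.IsMulRightInvariant]
    (t : Measure ↥(epsCentralizer ε δ)) [IsHaarMeasure t] [t.IsInvInvariant]
    (t' : Measure ↥((epsCentralizer ε δ).subgroupOf A)) [IsHaarMeasure t'] [t'.IsInvInvariant]
    (ht' : t' = Measure.map (Subgroup.subgroupOfEquivOfLe hTA).symm t) :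
    quotientMeasure ((epsCentralizer ε δ).subgroupOf A) t' (isClosed_subgroupOf (epsCentralizer ε δ) A hT) α
        {z | descEpsConj ε δ (epsCentralizer ε δ) (fun m => iwasawaExp hϖ m) (inclQuot (epsCentralizer ε δ) A z) = iwasawaExp hϖ δ} *
      t (Subtype.val ⁻¹' (glInt 3 K : Set (GL (Fin 3) K))) = α {a : ↥A | (a : GL (Fin 3) K) ∈ glInt 3 K} := by
  haveI : IsClosed (A : Set (GL (Fin 3) K)) := hA
  haveI : LocallyCompactSpace ↥A := hA.isClosedEmbedding_subtypeVal.locallyCompactSpace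
  haveI : SecondCountableTopology ↥A := TopologicalSpace.Subtype.secondCountableTopology _
  haveI : IsClosed (((epsCentralizer ε δ).subgroupOf A : Subgroup ↥A) : Set ↥A) := isClosed_subgroupOf (epsCentralizer ε δ) A hT
  haveI : BorelSpace ↥((epsCentralizer ε δ).subgroupOf A) := Subtype.borelSpace _
  haveI : BorelSpace ↥(epsCentralizer ε δ) := Subtype.borelSpace _
  haveI : SecondCountableTopology ↥((epsCentralizer ε δ).subgroupOf A) := TopologicalSpace.Subtype.secondCountableTopology _
  haveI : LocallyCompactSpace ↥((epsCentralizer ε δ).subgroupOf A) :=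
    (isClosed_subgroupOf (epsCentralizer ε δ) A hT).isClosedEmbedding_subtypeVal.locallyCompactSpace
  haveI : SFinite t' := inferInstance
  have hopen : IsOpen (((glInt 3 K).subgroupOf A : Subgroup ↥A) : Set ↥A) := (isOpen_glInt 3 K).preimage continuous_subtype_val
  rw [setOf_descEpsConj_iwasawaExp_eq_image_mk hϖ σ hσ hσc ε hεΘ δ d hδ hAid hTA]
  have hmass := quotientMeasure_image_mk_mul_eq ((epsCentralizer ε δ).subgroupOf A) t' α ((glInt 3 K).subgroupOf A) hopen
  -- `t′(T ∩ (A ∩ K̃)) = t(T ∩ K̃)` (transport)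
  have htrans : t' (Subtype.val ⁻¹' (((glInt 3 K).subgroupOf A : Subgroup ↥A) : Set ↥A)) = t (Subtype.val ⁻¹' (glInt 3 K : Set (GL (Fin 3) K))) := by
    rw [ht', Measure.map_apply (continuous_subgroupOfEquivOfLe_symm (epsCentralizer ε δ) A hTA).measurable (hopen.preimage continuous_subtype_val).measurableSet]
    rfl
  rw [htrans] at hmass
  exact hmass

end Anchor

end Summit.HodgeConjecture.HodgeConjecture.R90.S6

end
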